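import Summits.Ventures.QEC.Census.FoldFiber2
import Summits.Ventures.QEC.CircuitDistance.ETowerDefs
import HarnessLib

/-!
# P3-PORT STEP 2 (E-fold tower): `k`-BLOCK FOLD GEOMETRY — words, parts, reconstruction, weights
# (cell `qec`, experiment CDX, seat qec-cdx-type-1; CARD-7 §5 / PORT-SPEC §1–2, twin of `Census.FoldFiber` §Geo)

The Census fold machinery (`Census.Fold.Geo`: `foldIdx / emb / partner` act on `(J / lm, J % lm)` and carry the block
coordinate through) is block-agnostic except for the word lengths `Geo.n = 2·lm`, `Geo.ns = 2·ls·ms`.  Here the same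
objects on `nb` blocks: `nK G nb = nb·lm` big slots, `nsK G nb = nb·ls·ms` small slots; the fold `foldWK`, section /
partner parts `aPartK / bPartK`, placements `embWK / parWK`, the doubled word `doubleK`, the index facts `OKK` (decided per
level by `OKK_iff`), and the twins of the `FoldFiber` lemmas the fibre-completeness proof uses: additivity, RECONSTRUCTION
`reconK`, disjointness, WEIGHT `popc_eq_partsK`, the masks of `mkWord`, syndromes through the placements (for an arbitrary
column function `col`).  Proofs are the Census proofs with `G.n ↦ nK G nb`, `G.ns ↦ nsK G nb`.  Generic; no data.
-/

namespace Summit.Ventures.QEC.CircuitDistance.ETower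

open Summit.Ventures.QEC.Census Summit.Ventures.QEC.Census.Fold

/-! ## `k`-block words -/

/-- Big slot count on `nb` blocks. -/
def nK (G : Geo) (nb : ℕ) : ℕ := nb * (G.l * G.m)

/-- Small slot count on `nb` blocks. -/
def nsK (G : Geo) (nb : ℕ) : ℕ := nb * (G.ls * G.ms)

/-- The fold of a big `nb`-block word. -/
def foldWK (G : Geo) (nb : ℕ) (u : ℕ) : ℕ := lin (fun J => 2 ^ G.foldIdx J) (nK G nb) 0 u

/-- Section part of a big word, in small coordinates. -/
def aPartK (G : Geo) (nb : ℕ) (u : ℕ) : ℕ := lin (fun J => if G.isEmb J then 2 ^ G.foldIdx J else 0) (nK G nb) 0 u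

/-- Partner part of a big word, in small coordinates. -/
def bPartK (G : Geo) (nb : ℕ) (u : ℕ) : ℕ := lin (fun J => if G.isEmb J then 0 else 2 ^ G.foldIdx J) (nK G nb) 0 u

/-- Place a small word on the section points. -/
def embWK (G : Geo) (nb : ℕ) (y : ℕ) : ℕ := lin (fun j => 2 ^ G.emb j) (nsK G nb) 0 y

/-- Place a small word on the partner points. -/
def parWK (G : Geo) (nb : ℕ) (y : ℕ) : ℕ := lin (fun j => 2 ^ G.partner (G.emb j)) (nsK G nb) 0 y

/-- The doubled word (fold `0`). -/
def doubleK (G : Geo) (nb : ℕ) (c : ℕ) : ℕ := embWK G nb c ^^^ parWK G nb c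

/-- The index facts of a `k`-block fold step (decided per level via `OKK_iff`). -/
structure OKK (G : Geo) (nb : ℕ) : Prop where
  /-- section points are big indices -/
  emb_lt : ∀ j, j < nsK G nb → G.emb j < nK G nb
  /-- partners are big indices -/
  partner_lt : ∀ J, J < nK G nb → G.partner J < nK G nb
  /-- folds are small indices -/
  foldIdx_lt : ∀ J, J < nK G nb → G.foldIdx J < nsK G nb
  /-- the section is a section -/
  fold_emb : ∀ j, j < nsK G nb → G.foldIdx (G.emb j) = j
  /-- partners lie in the same fibre -/
  fold_partner : ∀ J, J < nK G nb → G.foldIdx (G.partner J) = G.foldIdx J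
  /-- a partner of a section point is not a section point -/
  partner_emb_ne : ∀ j, j < nsK G nb → G.partner (G.emb j) ≠ G.emb j
  /-- `partner` is an involution -/
  partner_partner : ∀ J, J < nK G nb → G.partner (G.partner J) = J
  /-- every big index is the section point of its fibre or that point's partner -/
  cover : ∀ J, J < nK G nb → G.emb (G.foldIdx J) = J ∨ G.partner (G.emb (G.foldIdx J)) = J

/-- `OKK` as a decidable conjunction. -/
theorem OKK_iff (G : Geo) (nb : ℕ) :
    OKK G nb ↔ ((∀ j, j < nsK G nb → G.emb j < nK G nb) ∧ (∀ J, J < nK G nb → G.partner J < nK G nb) ∧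
      (∀ J, J < nK G nb → G.foldIdx J < nsK G nb) ∧ (∀ j, j < nsK G nb → G.foldIdx (G.emb j) = j) ∧
      (∀ J, J < nK G nb → G.foldIdx (G.partner J) = G.foldIdx J) ∧
      (∀ j, j < nsK G nb → G.partner (G.emb j) ≠ G.emb j) ∧ (∀ J, J < nK G nb → G.partner (G.partner J) = J) ∧
      (∀ J, J < nK G nb → G.emb (G.foldIdx J) = J ∨ G.partner (G.emb (G.foldIdx J)) = J)) :=
  ⟨fun ⟨h1, h2, h3, h4, h5, h6, h7, h8⟩ => ⟨h1, h2, h3, h4, h5, h6, h7, h8⟩,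
   fun ⟨h1, h2, h3, h4, h5, h6, h7, h8⟩ => ⟨h1, h2, h3, h4, h5, h6, h7, h8⟩⟩

/-- Kernel membership for a column function read on `n` bits. -/
def kerK (col : ℕ → ℕ) (n : ℕ) (u : ℕ) : Prop := lin col n 0 u = 0

section Parts

variable {G : Geo} {nb : ℕ}

/-! ## Additivity -/

/-- `embWK` is additive. -/
theorem embWK_xor (G : Geo) (nb x y : ℕ) : embWK G nb (x ^^^ y) = embWK G nb x ^^^ embWK G nb y := lin_xor _ _ _ _ _
/-- `parWK` is additive. -/
theorem parWK_xor (G : Geo) (nb x y : ℕ) : parWK G nb (x ^^^ y) = parWK G nb x ^^^ parWK G nb y := lin_xor _ _ _ _ _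
/-- `foldWK` is additive. -/
theorem foldWK_xor (G : Geo) (nb x y : ℕ) : foldWK G nb (x ^^^ y) = foldWK G nb x ^^^ foldWK G nb y := lin_xor _ _ _ _ _
/-- `aPartK` is additive. -/
theorem aPartK_xor (G : Geo) (nb x y : ℕ) : aPartK G nb (x ^^^ y) = aPartK G nb x ^^^ aPartK G nb y := lin_xor _ _ _ _ _
/-- `bPartK` is additive. -/
theorem bPartK_xor (G : Geo) (nb x y : ℕ) : bPartK G nb (x ^^^ y) = bPartK G nb x ^^^ bPartK G nb y := lin_xor _ _ _ _ _
/-- `embWK 0 = 0`. -/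
@[simp] theorem embWK_zero (G : Geo) (nb : ℕ) : embWK G nb 0 = 0 := lin_zero _ _ _
/-- `parWK 0 = 0`. -/
@[simp] theorem parWK_zero (G : Geo) (nb : ℕ) : parWK G nb 0 = 0 := lin_zero _ _ _
/-- `foldWK 0 = 0`. -/
@[simp] theorem foldWK_zero (G : Geo) (nb : ℕ) : foldWK G nb 0 = 0 := lin_zero _ _ _
/-- `doubleK` is additive. -/
theorem doubleK_xor (G : Geo) (nb x y : ℕ) : doubleK G nb (x ^^^ y) = doubleK G nb x ^^^ doubleK G nb y := by
  unfold doubleK; rw [embWK_xor, parWK_xor]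
  simp only [Nat.xor_assoc, Nat.xor_left_comm]

/-- `embWK` of a unit vector. -/
theorem embWK_two_pow {j : ℕ} (hj : j < nsK G nb) : embWK G nb (2 ^ j) = 2 ^ G.emb j := by
  rw [embWK, lin_two_pow _ _ 0 j hj, Nat.zero_add]
/-- `parWK` of a unit vector. -/
theorem parWK_two_pow {j : ℕ} (hj : j < nsK G nb) : parWK G nb (2 ^ j) = 2 ^ G.partner (G.emb j) := by
  rw [parWK, lin_two_pow _ _ 0 j hj, Nat.zero_add]
/-- `foldWK` of a unit vector. -/
theorem foldWK_two_pow {J : ℕ} (hJ : J < nK G nb) : foldWK G nb (2 ^ J) = 2 ^ G.foldIdx J := by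
  rw [foldWK, lin_two_pow _ _ 0 J hJ, Nat.zero_add]
/-- The fold splits into section and partner parts. -/
theorem foldWK_eq_parts (u : ℕ) : foldWK G nb u = aPartK G nb u ^^^ bPartK G nb u := by
  rw [foldWK, aPartK, bPartK, ← lin_xor_fun]
  exact lin_congr (i0 := 0) (fun J _ => by cases G.isEmb (0 + J) <;> simp) u
/-- **RECONSTRUCTION**: a big word is its section part on the section points plus its partner part on the partner points. -/
theorem reconK (hG : OKK G nb) {u : ℕ} (hu : u < 2 ^ nK G nb) :
    u = embWK G nb (aPartK G nb u) ^^^ parWK G nb (bPartK G nb u) := by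
  rw [aPartK, bPartK, map_lin_of_xor (embWK G nb) (embWK_zero G nb) (embWK_xor G nb),
    map_lin_of_xor (parWK G nb) (parWK_zero G nb) (parWK_xor G nb), ← lin_xor_fun]
  conv_lhs => rw [← Nat.mod_eq_of_lt hu, ← lin_pow_self]
  refine lin_congr (i0 := 0) (fun J hJ => ?_) u
  rw [Nat.zero_add]
  rcases hG.cover J hJ with h | h
  · have hE : G.isEmb J = true := by simp [Geo.isEmb, h]
    rw [hE]; simp only [if_true]
    rw [embWK_two_pow (hG.foldIdx_lt J hJ), h, parWK_zero, Nat.xor_zero]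
  · have hE : G.isEmb J = false := by
      simp only [Geo.isEmb, beq_eq_false_iff_ne]
      intro h'
      exact hG.partner_emb_ne _ (hG.foldIdx_lt J hJ) (h.trans h'.symm)
    rw [hE]; simp only [Bool.false_eq_true, if_false]
    rw [parWK_two_pow (hG.foldIdx_lt J hJ), h, embWK_zero, Nat.zero_xor]
/-- Injectivity of the section on the window. -/
theorem emb_injK (hG : OKK G nb) {j₁ j₂ : ℕ} (h₁ : j₁ < nsK G nb) (h₂ : j₂ < nsK G nb) (h : G.emb j₁ = G.emb j₂) :
    j₁ = j₂ := by
  rw [← hG.fold_emb j₁ h₁, ← hG.fold_emb j₂ h₂, h]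
/-- Injectivity of the partner-of-section map on the window. -/
theorem partner_emb_injK (hG : OKK G nb) {j₁ j₂ : ℕ} (h₁ : j₁ < nsK G nb) (h₂ : j₂ < nsK G nb)
    (h : G.partner (G.emb j₁) = G.partner (G.emb j₂)) : j₁ = j₂ := by
  apply emb_injK hG h₁ h₂
  rw [← hG.partner_partner _ (hG.emb_lt j₁ h₁), h, hG.partner_partner _ (hG.emb_lt j₂ h₂)]
/-- Bits of a section placement. -/
theorem testBit_embWK (hG : OKK G nb) {y J : ℕ} :
    (embWK G nb y).testBit J = true ↔ ∃ j, j < nsK G nb ∧ y.testBit j = true ∧ G.emb j = J := by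
  rw [embWK, testBit_lin_pow_iff]
  · simp
  · intro k₁ k₂ h₁ h₂ h; simp only [Nat.zero_add] at h; exact emb_injK hG h₁ h₂ h
/-- Bits of a partner placement. -/
theorem testBit_parWK (hG : OKK G nb) {z J : ℕ} :
    (parWK G nb z).testBit J = true ↔ ∃ j, j < nsK G nb ∧ z.testBit j = true ∧ G.partner (G.emb j) = J := by
  rw [parWK, testBit_lin_pow_iff]
  · simp
  · intro k₁ k₂ h₁ h₂ h; simp only [Nat.zero_add] at h; exact partner_emb_injK hG h₁ h₂ h
/-- Section and partner placements are disjoint. -/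
theorem embWK_and_parWK (hG : OKK G nb) (y z : ℕ) : embWK G nb y &&& parWK G nb z = 0 := by
  apply Nat.eq_of_testBit_eq; intro J
  rw [Nat.testBit_and, Nat.zero_testBit, Bool.and_eq_false_iff]
  by_contra h
  push Not at h
  obtain ⟨j, hj, -, hJ⟩ := (testBit_embWK hG).1 (by simpa using h.1)
  obtain ⟨j', hj', -, hJ'⟩ := (testBit_parWK hG).1 (by simpa using h.2)
  have : j' = j := by
    have := hG.fold_partner _ (hG.emb_lt j' hj')
    rw [hJ', ← hJ, hG.fold_emb j hj, hG.fold_emb j' hj'] at this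
    exact this.symm
  subst this
  exact hG.partner_emb_ne j' hj' (hJ'.trans hJ.symm)
/-- Weight of a section placement. -/
theorem popc_embWK (hG : OKK G nb) (y : ℕ) : popc (nK G nb) (embWK G nb y) = popc (nsK G nb) y :=
  popc_lin_pow_inj _ _ _ _ (fun _ _ h₁ h₂ h => emb_injK hG h₁ h₂ h) hG.emb_lt
/-- Weight of a partner placement. -/
theorem popc_parWK (hG : OKK G nb) (z : ℕ) : popc (nK G nb) (parWK G nb z) = popc (nsK G nb) z :=
  popc_lin_pow_inj _ _ _ _ (fun _ _ h₁ h₂ h => partner_emb_injK hG h₁ h₂ h)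
    (fun k hk => hG.partner_lt _ (hG.emb_lt k hk))
/-- **WEIGHT**: `|u| = |a| + |b|`. -/
theorem popc_eq_partsK (hG : OKK G nb) {u : ℕ} (hu : u < 2 ^ nK G nb) :
    popc (nK G nb) u = popc (nsK G nb) (aPartK G nb u) + popc (nsK G nb) (bPartK G nb u) := by
  conv_lhs => rw [reconK hG hu]
  rw [popc_xor_of_and_eq_zero (embWK_and_parWK hG _ _), popc_embWK hG, popc_parWK hG]
/-- The section part is a small word. -/
theorem aPartK_lt (hG : OKK G nb) (u : ℕ) : aPartK G nb u < 2 ^ nsK G nb :=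
  lin_lt_two_pow _ _ _ (fun J hJ => by
    split
    · exact Nat.pow_lt_pow_right (by norm_num) (hG.foldIdx_lt J hJ)
    · exact Nat.two_pow_pos _) u
/-- The partner part is a small word. -/
theorem bPartK_lt (hG : OKK G nb) (u : ℕ) : bPartK G nb u < 2 ^ nsK G nb :=
  lin_lt_two_pow _ _ _ (fun J hJ => by
    split
    · exact Nat.two_pow_pos _
    · exact Nat.pow_lt_pow_right (by norm_num) (hG.foldIdx_lt J hJ)) u
/-- The fold is a small word. -/
theorem foldWK_lt (hG : OKK G nb) (u : ℕ) : foldWK G nb u < 2 ^ nsK G nb :=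
  lin_lt_two_pow _ _ _ (fun J hJ => Nat.pow_lt_pow_right (by norm_num) (hG.foldIdx_lt J hJ)) u
/-- A section placement is a big word. -/
theorem embWK_lt (hG : OKK G nb) (y : ℕ) : embWK G nb y < 2 ^ nK G nb :=
  lin_lt_two_pow _ _ _ (fun j hj => Nat.pow_lt_pow_right (by norm_num) (hG.emb_lt j hj)) y
/-- A partner placement is a big word. -/
theorem parWK_lt (hG : OKK G nb) (y : ℕ) : parWK G nb y < 2 ^ nK G nb :=
  lin_lt_two_pow _ _ _ (fun j hj => Nat.pow_lt_pow_right (by norm_num) (hG.partner_lt _ (hG.emb_lt j hj))) y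
/-- A doubled word is a big word. -/
theorem doubleK_lt (hG : OKK G nb) (c : ℕ) : doubleK G nb c < 2 ^ nK G nb :=
  Nat.xor_lt_two_pow (embWK_lt hG c) (parWK_lt hG c)
/-- The fold of a section placement. -/
theorem foldWK_embWK (hG : OKK G nb) {y : ℕ} (hy : y < 2 ^ nsK G nb) : foldWK G nb (embWK G nb y) = y := by
  rw [embWK, foldWK, lin_lin]
  conv_rhs => rw [← Nat.mod_eq_of_lt hy, ← lin_pow_self]
  exact lin_congr (i0 := 0) (fun j hj => by
    rw [Nat.zero_add, lin_two_pow _ _ 0 _ (hG.emb_lt j hj), Nat.zero_add, hG.fold_emb j hj]) y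
/-- The fold of a partner placement. -/
theorem foldWK_parWK (hG : OKK G nb) {y : ℕ} (hy : y < 2 ^ nsK G nb) : foldWK G nb (parWK G nb y) = y := by
  rw [parWK, foldWK, lin_lin]
  conv_rhs => rw [← Nat.mod_eq_of_lt hy, ← lin_pow_self]
  exact lin_congr (i0 := 0) (fun j hj => by
    rw [Nat.zero_add, lin_two_pow _ _ 0 _ (hG.partner_lt _ (hG.emb_lt j hj)), Nat.zero_add,
      hG.fold_partner _ (hG.emb_lt j hj), hG.fold_emb j hj]) y
/-- A doubled word folds to `0`. -/
theorem foldWK_doubleK (hG : OKK G nb) {c : ℕ} (hc : c < 2 ^ nsK G nb) : foldWK G nb (doubleK G nb c) = 0 := by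
  rw [doubleK, foldWK_xor, foldWK_embWK hG hc, foldWK_parWK hG hc, Nat.xor_self]

/-! ## The words produced by `mkWord` (window `nsK`) -/

/-- Mask of the section images of a list. -/
theorem maskOf_map_embK (e : List ℕ) (he : ∀ j ∈ e, j < nsK G nb) : maskOf (e.map G.emb) = embWK G nb (maskOf e) := by
  rw [maskOf, xorIdx_map, embWK, ← xorIdx_eq_lin _ _ _ he]; rfl
/-- Mask of the partner images of a list. -/
theorem maskOf_map_partner_embK (e : List ℕ) (he : ∀ j ∈ e, j < nsK G nb) :
    maskOf (e.map fun j => G.partner (G.emb j)) = parWK G nb (maskOf e) := by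
  rw [maskOf, xorIdx_map, parWK, ← xorIdx_eq_lin _ _ _ he]; rfl
/-- Mask of the `P`-part of `mkWord`. -/
theorem maskOf_xorSelIdxK (P : List ℕ) (hP : ∀ j ∈ P, j < nsK G nb) (x : ℕ) :
    maskOf (mkWord.xorSelIdx G P x) =
      embWK G nb (lin (fun k => 2 ^ P.getD k 0) P.length 0 x) ^^^
        parWK G nb (maskOf P ^^^ lin (fun k => 2 ^ P.getD k 0) P.length 0 x) := by
  induction P generalizing x with
  | nil => simp [mkWord.xorSelIdx]
  | cons j P ih =>
    have hj : j < nsK G nb := hP j (by simp)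
    rw [mkWord.xorSelIdx, maskOf_cons, ih (fun i hi => hP i (by simp [hi])) (x / 2), List.length_cons, lin_succ_zero,
      maskOf_cons]
    simp only [List.getD_cons_zero, List.getD_cons_succ]
    split
    · simp only [embWK_xor, parWK_xor, embWK_two_pow hj, Nat.xor_assoc, Nat.xor_left_comm,
        xor_cancel_left]
    · simp only [parWK_xor, parWK_two_pow hj, Nat.xor_assoc, Nat.xor_left_comm, Nat.zero_xor]
/-- Mask of a produced word. -/
theorem maskOf_mkWordK (P e : List ℕ) (hP : ∀ j ∈ P, j < nsK G nb) (he : ∀ j ∈ e, j < nsK G nb) (x : ℕ) :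
    maskOf (mkWord G P e x) =
      embWK G nb (maskOf e ^^^ lin (fun k => 2 ^ P.getD k 0) P.length 0 x) ^^^
        parWK G nb (maskOf e ^^^ (maskOf P ^^^ lin (fun k => 2 ^ P.getD k 0) P.length 0 x)) := by
  rw [mkWord, maskOf_append, maskOf_append, maskOf_map_embK e he, maskOf_map_partner_embK e he,
    maskOf_xorSelIdxK P hP, embWK_xor, parWK_xor G nb (maskOf e)]
  simp only [Nat.xor_assoc, Nat.xor_left_comm]
/-- Every index produced by `mkWord` is a big index. -/
theorem mkWord_boundK (hG : OKK G nb) (P e : List ℕ) (hP : ∀ j ∈ P, j < nsK G nb) (he : ∀ j ∈ e, j < nsK G nb)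
    (x : ℕ) : ∀ J ∈ mkWord G P e x, J < nK G nb := by
  intro J hJ
  rw [mkWord, List.mem_append, List.mem_append] at hJ
  rcases hJ with (hJ | hJ) | hJ
  · rw [List.mem_map] at hJ; obtain ⟨j, hj, rfl⟩ := hJ; exact hG.emb_lt j (he j hj)
  · rw [List.mem_map] at hJ; obtain ⟨j, hj, rfl⟩ := hJ; exact hG.partner_lt _ (hG.emb_lt j (he j hj))
  · suffices h : ∀ (Q : List ℕ) (y : ℕ), (∀ j ∈ Q, j < nsK G nb) → ∀ J ∈ mkWord.xorSelIdx G Q y, J < nK G nb from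
      h P x hP J hJ
    intro Q
    induction Q with
    | nil => intro y _ J hJ; simp [mkWord.xorSelIdx] at hJ
    | cons j Q ih =>
      intro y hQ J hJ
      rw [mkWord.xorSelIdx, List.mem_cons] at hJ
      rcases hJ with rfl | hJ
      · split
        · exact hG.emb_lt j (hQ j (by simp))
        · exact hG.partner_lt _ (hG.emb_lt j (hQ j (by simp)))
      · exact ih (y / 2) (fun i hi => hQ i (by simp [hi])) J hJ

/-! ## Syndromes through the placements (any column function) -/

/-- Syndrome of a section placement. -/
theorem lin_col_embWK (hG : OKK G nb) (col : ℕ → ℕ) (y : ℕ) :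
    lin col (nK G nb) 0 (embWK G nb y) = lin (fun j => col (G.emb j)) (nsK G nb) 0 y := by
  rw [embWK, lin_lin]
  exact lin_congr (i0 := 0) (fun j hj => by rw [Nat.zero_add, lin_two_pow _ _ 0 _ (hG.emb_lt j hj), Nat.zero_add]) y
/-- Syndrome of a partner placement. -/
theorem lin_col_parWK (hG : OKK G nb) (col : ℕ → ℕ) (y : ℕ) :
    lin col (nK G nb) 0 (parWK G nb y) = lin (fun j => col (G.partner (G.emb j))) (nsK G nb) 0 y := by
  rw [parWK, lin_lin]
  exact lin_congr (i0 := 0) (fun j hj => by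
    rw [Nat.zero_add, lin_two_pow _ _ 0 _ (hG.partner_lt _ (hG.emb_lt j hj)), Nat.zero_add]) y

end Parts

end Summit.Ventures.QEC.CircuitDistance.ETower
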